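import Literature.Probability.Percolation.SlabRSWSnapDatum
import Literature.Probability.Percolation.SlabRSWLemma316
import HarnessLib

/-!
# Newman–Tassion–Wu 2017, Lemma 3.16 on the coarse-grained domain — separation and connector walks

Topic: `Literature/Probability/Percolation`. First half of the probabilistic chain of Lemma 3.16
(gluing step of Case 3 of Theorem 3.14, arXiv:1512.09107 pp. 16–17) for the COARSE-GRAINED gluing
datum `Q₂ = snapGlue k n hn Γ` of `SlabRSWSnapDatum.lean` (`S = R' ∖ N(Γ)`, `B = τN(Γ) ∖ N(Γ)`,
tiles of mesh `40`), which replaces the datum `mirrorGlue n hn Γ ρ₂` (`S = R' ∖ 𝒩(Γ, ρ₂)`, thin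
target `τΓ̄`) of `SlabRSWCase3Separation/Case3Crossing/Lemma316.lean`:

* `evAB_mirrorGlue_subset_snapGlue` — (SEP₂) `{C ⟷^{R'∖𝒩(Γ,60)} τΓ̄} ⊆ {C ⟷^{R'∖N} τN∖N}`
  (`N ⊆ 𝒩(Γ,60)`, `Γ̄ ⊆ N`), hence `real_evOff_explored_le_toSnap`:
  `P[C ⟷^{R'∖𝒞(ω)} 𝖡] ≤ P[Q₂.evAB]` for the explored set at radius `60`;
* planar-walk tools: `IsPlanarWalk.map_of` (maps sending adjacent cells to equal or adjacent
  cells), `IsPlanarWalk.push` (the push `(x, y) ↦ (min x t, y)`), `exists_planarWalk_boxR` (two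
  cells of a rectangle are joined by a planar walk inside it);
* **`exists_connector`** — for `g ∈ Γ` and a cell `t` of the tile of `g` inside `R'` with
  `t.1 ≤ 7n - 1`, a planar walk from `t` to `Γ̄₀ = (0, a₂)` inside `N(Γ) ∩ [0,7n-1]×[0,13n-1]`
  (an L-walk in the clipped tile, then the projection of the prefix of `Γ` up to `g` pushed by
  `x ↦ min x (7n-1)`): the piece of the top–bottom walk of the crossing step that lives inside
  `N(Γ)` (next file, `SlabRSWSnapMirror.lean`).

## Sources

* C. M. Newman, V. Tassion, W. Wu, *Critical percolation and the minimal spanning tree in slabs*,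
  Comm. Pure Appl. Math. 70 (2017), arXiv:1512.09107: §3.5, Lemma 3.16 and its proof (the sets
  `K(γ) ⊇ K_□`, `Y`, `Y'`, `γ'`; "`K_□` is regular enough to apply Theorem 3.6"), proof of
  Theorem 3.14, Case 3 ((3.49)) [NewmanTassionWu2017].
-/

noncomputable section

namespace Literature.Probability.Percolation

open MeasureTheory LatticeModels SimpleGraph

namespace NTW17

variable {k : ℕ}

/-! ## Planar-walk tools -/

section Walks

/-- A map sending adjacent cells to equal or adjacent cells maps planar walks to planar walks.
[cite: NewmanTassionWu2017, §3.2 (Theorem 3.6, "the projection on ℤ² of any path")] -/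
theorem IsPlanarWalk.map_of {f : ℤ × ℤ → ℤ × ℤ}
    (hf : ∀ z w, planarAdj z w → f z = f w ∨ planarAdj (f z) (f w)) {l : List (ℤ × ℤ)}
    (h : IsPlanarWalk l) : IsPlanarWalk (l.map f) := by
  rw [IsPlanarWalk, List.isChain_map]
  refine List.IsChain.imp (fun a b hab => ?_) h
  rcases hab with hab | hab
  · exact Or.inl (by rw [hab])
  · exact hf a b hab

/-- **The push `(x, y) ↦ (min x t, y)`** onto the half-plane `{x ≤ t}` maps planar walks to planar
walks (adjacent cells go to equal or adjacent cells).
[cite: NewmanTassionWu2017, §3.5 (proof of Lemma 3.16, the paths γ, γ′ on either side of the axis)] -/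
theorem IsPlanarWalk.push (t : ℤ) {l : List (ℤ × ℤ)} (h : IsPlanarWalk l) :
    IsPlanarWalk (l.map fun z => (min z.1 t, z.2)) := by
  refine h.map_of fun z w hzw => ?_
  simp only [planarAdj, Prod.ext_iff, Prod.fst_add, Prod.snd_add] at hzw ⊢
  omega

/-- **Two cells of a rectangle are joined by a planar walk inside it** (induction on the
`ℓ¹`-distance: step one unit towards the target). [cite: NewmanTassionWu2017, §3.5 (proof of Lemma 3.16, "K_□ is regular enough")] -/
theorem exists_planarWalk_boxR_aux {a b c d : ℤ} :
    ∀ (m : ℕ) (u v : ℤ × ℤ), u ∈ boxR a b c d → v ∈ boxR a b c d →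
      (v.1 - u.1).natAbs + (v.2 - u.2).natAbs ≤ m →
      ∃ l : List (ℤ × ℤ), IsPlanarWalk (u :: l) ∧ (u :: l).getLast (List.cons_ne_nil u l) = v ∧
        ∀ z ∈ u :: l, z ∈ boxR a b c d := by
  intro m
  induction m with
  | zero =>
    intro u v hu _ hm
    have huv : u = v := by ext <;> omega
    subst huv
    exact ⟨[], List.IsChain.singleton _, by simp, fun z hz => by simp at hz; subst hz; exact hu⟩
  | succ m ih =>
    intro u v hu hv hm
    by_cases huv : u = v
    · subst huv
      exact ⟨[], List.IsChain.singleton _, by simp, fun z hz => by simp at hz; subst hz; exact hu⟩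
    · -- one step towards `v`
      rw [mem_boxR_iff] at hu hv
      obtain ⟨u', hu', hadj, hm'⟩ : ∃ u' : ℤ × ℤ, u' ∈ boxR a b c d ∧ planarAdj u u' ∧
          (v.1 - u'.1).natAbs + (v.2 - u'.2).natAbs ≤ m := by
        have hne : u.1 ≠ v.1 ∨ u.2 ≠ v.2 := by
          by_contra h; apply huv; ext <;> omega
        by_cases h1 : u.1 < v.1
        · refine ⟨(u.1 + 1, u.2), by rw [mem_boxR_iff]; simp only; omega, ?_, by simp only; omega⟩
          left; left; ext <;> simp
        by_cases h2 : v.1 < u.1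
        · refine ⟨(u.1 - 1, u.2), by rw [mem_boxR_iff]; simp only; omega, ?_, by simp only; omega⟩
          left; right; ext <;> simp
        by_cases h3 : u.2 < v.2
        · refine ⟨(u.1, u.2 + 1), by rw [mem_boxR_iff]; simp only; omega, ?_, by simp only; omega⟩
          right; left; ext <;> simp
        · refine ⟨(u.1, u.2 - 1), by rw [mem_boxR_iff]; simp only; omega, ?_, by simp only; omega⟩
          right; right; ext <;> simp
      obtain ⟨l, hl, hlast, hmem⟩ := ih u' v hu' (by rw [mem_boxR_iff]; exact hv) hm'
      refine ⟨u' :: l, List.IsChain.cons_of_ne_nil (List.cons_ne_nil _ _) hl (Or.inr hadj), ?_, ?_⟩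
      · rw [List.getLast_cons (List.cons_ne_nil _ _)]; exact hlast
      · intro z hz
        rcases List.mem_cons.1 hz with rfl | hz
        · rw [mem_boxR_iff]; exact hu
        · exact hmem z hz

/-- **Two cells of a rectangle are joined by a planar walk inside it.**
[cite: NewmanTassionWu2017, §3.5 (proof of Lemma 3.16, "K_□ is regular enough")] -/
theorem exists_planarWalk_boxR {a b c d : ℤ} {u v : ℤ × ℤ} (hu : u ∈ boxR a b c d)
    (hv : v ∈ boxR a b c d) :
    ∃ l : List (ℤ × ℤ), l ≠ [] ∧ IsPlanarWalk l ∧ l.head? = some u ∧ l.getLast? = some v ∧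
      ∀ z ∈ l, z ∈ boxR a b c d := by
  obtain ⟨l, hl, hlast, hmem⟩ := exists_planarWalk_boxR_aux _ u v hu hv le_rfl
  exact ⟨u :: l, List.cons_ne_nil _ _, hl, rfl, by rw [List.getLast?_eq_some_getLast (List.cons_ne_nil u l), hlast],
    hmem⟩

end Walks

/-! ## The separation step transferred to the coarse datum -/

section Sep

variable {n : ℕ} (hn : 1 ≤ n) (Γ : List (slab 3 k))

/-- **(SEP₂)** `{C ⟷^{R' ∖ 𝒩(Γ,60)} τΓ̄} ⊆ {C ⟷^{R' ∖ N(Γ)} τN(Γ) ∖ N(Γ)}`: the thin event of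
`mirrorGlue n hn Γ 60` implies the fat event of `snapGlue k n hn Γ`, because `N(Γ) ⊆ 𝒩(Γ, 60)` and
`Γ̄ ⊆ N(Γ)` (so the end cell, a mirror cell of `Γ̄` outside `𝒩(Γ,60)`, lies in `τN ∖ N`).
[cite: NewmanTassionWu2017, §3.5 (proof of Theorem 3.14, Case 3: the open path from Y to B(R) in R ∖ C reaches γ′, and K_□ ⊆ K(γ))] -/
theorem evAB_mirrorGlue_subset_snapGlue :
    (mirrorGlue n hn Γ 60).evAB k ⊆ (snapGlue k n hn Γ).evAB k := by
  intro ω hω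
  obtain ⟨l, hl⟩ := (mem_slabConn_iff_exists_isOSAP ω _ _ _).1 hω
  refine (mem_slabConn_iff_exists_isOSAP ω _ _ _).2
    ⟨l, ⟨hl.nodup, hl.chain, fun x hx => ?_, hl.ne_nil, hl.head_mem, fun h => ?_⟩⟩
  · have h1 : planar k x ∈ (case2Setup n hn).R ∧ ¬Near k Γ 60 (planar k x) := hl.subset x hx
    exact ⟨h1.1, not_mem_snapNbhd_of_not_near h1.2⟩
  · have h1 : ∃ g ∈ Γ, planar k (l.getLast h) = planarReflect (14 * (n : ℤ)) (planar k g) :=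
      hl.last_mem h
    have h2 : planar k (l.getLast h) ∈ (case2Setup n hn).R ∧ ¬Near k Γ 60 (planar k (l.getLast h)) :=
      hl.subset _ (List.getLast_mem h)
    obtain ⟨g, hg, hz⟩ := h1
    refine ⟨?_, not_mem_snapNbhd_of_not_near h2.2⟩
    show planar k (l.getLast h) ∈ snapNbhdR k n Γ
    rw [mem_snapNbhdR_iff, hz, reflect14_invol]
    exact planar_mem_snapNbhd hg

/-- **Measure form of (SEP₂)**: for an admissible lattice `ω` (`A ⟷^{S'} B`),
`P[C ⟷^{R' ∖ 𝒞(ω)} 𝖡] ≤ P[Q₂.evAB]`, `𝒞 = Q.explored 60`, `Q₂ = snapGlue k n hn (Γ ω)`.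
[cite: NewmanTassionWu2017, §3.5 (proof of Theorem 3.14, Case 3, (3.49): P[Y ⟷^{R∖C} B(R)] ≤ P[C_γ])] -/
theorem real_evOff_explored_le_toSnap {ω : BondConfig (slab 3 k)} (hω : ω ⊆ (slabGraph 3 k).edgeSet)
    (hA : ω ∈ (case2Setup n hn).Q.evAB k) (p : unitInterval) :
    (bondPercolation (slabGraph 3 k) p).real
        ((case2Setup n hn).Q.evOff k {z | z.2 = 0} ((case2Setup n hn).Q.explored k 60 ω)) ≤
      (bondPercolation (slabGraph 3 k) p).real ((snapGlue k n hn ((case2Setup n hn).Q.γ k ω)).evAB k) :=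
  (real_evOff_explored_le_toMirror hn hω hA p (ρ₂ := 60)).trans
    (measureReal_mono (evAB_mirrorGlue_subset_snapGlue hn _))

end Sep

/-! ## The connector walks inside `N(Γ)` -/

section Connector

variable {n : ℕ} (hn : 1 ≤ n) {ω : BondConfig (slab 3 k)}

/-- **The connector.** Let `ω` be admissible (lattice, `A ⟷^{S'} B`), `Γ = Q.γ ω`, `g ∈ Γ`, and `t` a
cell of the tile of `g` inside `R'` with `t.1 ≤ 7n - 1`. Then a planar walk joins `t` to the first cell
`Γ̄₀ = (0, a₂)` of `Γ` inside `N(Γ) ∩ [0, 7n-1] × [0, 13n-1]`: an L-walk inside the clipped tile, then the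
projection of the prefix of `Γ` up to `g`, pushed by `x ↦ min x (7n-1)` and reversed.
[cite: NewmanTassionWu2017, §3.5 (proof of Lemma 3.16: the paths γ ⊆ K(γ)ᶜ, "K_□ is regular enough")] -/
theorem exists_connector (hω : ω ⊆ (slabGraph 3 k).edgeSet) (hA : ω ∈ (case2Setup n hn).Q.evAB k)
    (h0 : (case2Setup n hn).Q.γ k ω ≠ []) {g : slab 3 k} (hg : g ∈ (case2Setup n hn).Q.γ k ω)
    {t : ℤ × ℤ} (ht : t ∈ sqBox (snap n (planar k g)) 40) (htR : t ∈ boxR 0 (14 * n) 0 (13 * n - 1))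
    (htx : t.1 ≤ 7 * n - 1) :
    ∃ W : List (ℤ × ℤ), W ≠ [] ∧ IsPlanarWalk W ∧ W.head? = some t ∧
      W.getLast? = some (planar k (((case2Setup n hn).Q.γ k ω).head h0)) ∧
      ∀ z ∈ W, z ∈ snapNbhd k n ((case2Setup n hn).Q.γ k ω) ∧ 0 ≤ z.1 ∧ z.1 ≤ 7 * n - 1 ∧
        0 ≤ z.2 ∧ z.2 ≤ 13 * n - 1 := by
  set E := case2Setup n hn with hE
  set Γ := E.Q.γ k ω with hΓdef
  obtain ⟨hΓO, -⟩ := E.Q.γ_spec hA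
  have hΓS' : ∀ g ∈ Γ, 0 ≤ (planar k g).1 ∧ (planar k g).1 ≤ 7 * n ∧ 0 ≤ (planar k g).2 ∧
      (planar k g).2 ≤ 8 * n - 1 := by
    intro g hg
    have := hΓO.subset g hg
    rw [mem_slabLift_iff, show E.Q.S = boxR 0 (7 * n) 0 (8 * n - 1) from rfl, mem_boxR_iff] at this
    exact this
  have haA : planar k (Γ.head h0) ∈ E.A := hΓO.head_mem h0
  rw [show E.A = sideSeg 0 0 (4 * n - 1) from rfl, sideSeg, Set.mem_setOf_eq] at haA
  -- the prefix of `Γ` up to `g`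
  obtain ⟨p, s, hps⟩ := List.append_of_mem hg
  obtain ⟨hw1, hne1, hhd1, hlt1, hmem1, -⟩ := prefix_facts hω hΓO hps
  set pre : List (ℤ × ℤ) := (p ++ [g]).map (planar k) with hpre
  have hhd1' : pre.head? = some (planar k (Γ.head h0)) := hhd1
  have hpreS : ∀ v ∈ pre, 0 ≤ v.1 ∧ v.1 ≤ 7 * n ∧ 0 ≤ v.2 ∧ v.2 ≤ 8 * n - 1 := by
    intro v hv
    obtain ⟨u, hu, rfl⟩ := List.mem_map.1 hv
    exact hΓS' u (hmem1 u hu)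
  have hpreN : ∀ v ∈ pre, sqBox v 20 ⊆ snapNbhd k n Γ := by
    intro v hv
    obtain ⟨u, hu, rfl⟩ := List.mem_map.1 hv
    exact sqBox_planar_subset_snapNbhd (hmem1 u hu)
  -- the clipped tile of `g`
  have hcb := snap_bounds n (planar k g)
  have hpg := hΓS' g hg
  rw [mem_sqBox_iff'] at ht
  rw [mem_boxR_iff] at htR
  push_cast at ht
  set c : ℤ × ℤ := snap n (planar k g) with hc
  set K : Set (ℤ × ℤ) := boxR (max (c.1 - 40) 0) (min (c.1 + 40) (7 * n - 1)) (max (c.2 - 40) 0)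
    (min (c.2 + 40) (13 * n - 1)) with hK
  have htK : t ∈ K := by rw [hK, mem_boxR_iff]; omega
  set e : ℤ × ℤ := (min (planar k g).1 (7 * (n : ℤ) - 1), (planar k g).2) with he
  have heK : e ∈ K := by
    rw [hK, mem_boxR_iff, he]; simp only; omega
  have hKN : ∀ z ∈ K, z ∈ snapNbhd k n Γ := by
    intro z hz
    rw [hK, mem_boxR_iff] at hz
    refine ⟨g, hg, ?_⟩
    show z ∈ sqBox c 40
    rw [mem_sqBox_iff']; push_cast; omega
  have hKc : ∀ z ∈ K, 0 ≤ z.1 ∧ z.1 ≤ 7 * n - 1 ∧ 0 ≤ z.2 ∧ z.2 ≤ 13 * n - 1 := by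
    intro z hz
    rw [hK, mem_boxR_iff] at hz
    omega
  -- the L-walk inside the clipped tile
  obtain ⟨l, hlne, hlw, hlhd, hllt, hlK⟩ := exists_planarWalk_boxR htK heK
  -- the pushed prefix, reversed
  set P : List (ℤ × ℤ) := (pre.map fun z : ℤ × ℤ => (min z.1 (7 * (n : ℤ) - 1), z.2)).reverse with hP
  have hPw : IsPlanarWalk P := isPlanarWalk_reverse (hw1.push _)
  have hPhd : P.head? = some e := by
    rw [hP, List.head?_reverse, List.getLast?_map, hlt1, Option.map_some]
  have hPlt : P.getLast? = some (planar k (Γ.head h0)) := by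
    rw [hP, List.getLast?_reverse, List.head?_map, hhd1', Option.map_some]
    congr 1
    ext
    · simp only; omega
    · rfl
  have hPmem : ∀ z ∈ P, z ∈ snapNbhd k n Γ ∧ 0 ≤ z.1 ∧ z.1 ≤ 7 * n - 1 ∧ 0 ≤ z.2 ∧ z.2 ≤ 13 * n - 1 := by
    intro z hz
    rw [hP, List.mem_reverse, List.mem_map] at hz
    obtain ⟨v, hv, rfl⟩ := hz
    have hb := hpreS v hv
    refine ⟨hpreN v hv ?_, ?_, ?_, ?_, ?_⟩
    · rw [mem_sqBox_iff']; push_cast; omega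
    all_goals (try dsimp only); omega
  refine ⟨l ++ P, by simp [hlne], isPlanarWalk_append hlw hPw fun x hx y hy => ?_, ?_, ?_, ?_⟩
  · rw [hllt, Option.mem_def, Option.some.injEq] at hx
    rw [hPhd, Option.mem_def, Option.some.injEq] at hy
    left; rw [← hx, ← hy]
  · rw [List.head?_append, hlhd, Option.some_or]
  · have hPne : P ≠ [] := by simp [hP, hpre]
    rw [List.getLast?_append, hPlt]; rfl
  · intro z hz
    rcases List.mem_append.1 hz with hz | hz
    · exact ⟨hKN z (hlK z hz), hKc z (hlK z hz)⟩
    · exact hPmem z hz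

end Connector

end NTW17

end Literature.Probability.Percolation
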